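import Summits.PneNP.PneNP.Theorems.OracleRefusal.Negative.StaInvLetters

/-!
# `OracleRefusal` (stmt-PneNP-1864) — negative side, II: Semantic inversion, part 4 (§B.6): the APPLIED LETTER `c b̲` — at most one copy of a letter point, slot `c` wrapped around
`![Pb‾ ⅋ p]` (`app1_runs`; `app1_exists` with any axiom label of the letter), and the quantifier tower of an applied
variable (`app1_ty`).
-/

namespace Summit.PneNP.PneNP.Theorems.OracleRefusal.Negative

open Literature.Computability.ImplicitComplexity
open Literature.Computability.ImplicitComplexity.URel
open Literature.Computability.ImplicitComplexity.STA (Deriv Ctx Term LinTy SoftTy encWord encBit tyS tyB tyF mpxRen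
  liftRen)

/-! ## §B.6 The applied letter `c b̲`: one wrapped leaf `![Pb‾ ⅋ p]` -/

/-- Argument cliques are monotone in the result set. [cite: LaurentTortoraDeFalco2006, Def. 12] -/
theorem argClique_mono {L L' : Set Point} (h : L ⊆ L') : ∀ k, argClique k L ⊆ argClique k L'
  | 0 => by
      intro x hx
      rcases mem_liftClique.1 hx with rfl | ⟨a, ha, rfl⟩
      · exact mem_liftClique.2 (Or.inl rfl)
      · exact mem_liftClique.2 (Or.inr ⟨a, h ha, rfl⟩)
  | k + 1 => by
      intro x hx
      rw [argClique_succ] at hx ⊢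
      obtain ⟨M, hM, rfl⟩ := hx
      exact ⟨M, fun y hy => argClique_mono h k (hM y hy), rfl⟩

/-- `(⊸E)`: the variable description of the function side survives juxtaposition with a junk argument side.
[cite: LaurentTortoraDeFalco2006, Def. 12] -/
theorem VarSpec.merge {Γ Γ₁ Γ₂ : Ctx} {i : ℕ} {ρ₁ ρ₂ : Val} {a : Point} (h : VarSpec Γ₁ i ρ₁ a)
    (hs : Γ.Split Γ₁ Γ₂) (h₁ : ∀ s, (ρ₁ s).isSome = (Γ₁ s).isSome) (h₂ : ∀ s, SlotIn Junk Γ₂ ρ₂ s) :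
    VarSpec Γ i (Val.merge ρ₁ ρ₂) a := by
  obtain ⟨⟨σ₀, hσ₀⟩, hW, hJ⟩ := h
  have hi : Γ₁ i = Γ i := by
    rcases hs i with ⟨h1, -⟩ | ⟨h1, -⟩
    · exact h1
    · rw [h1] at hσ₀; cases hσ₀
  refine ⟨⟨σ₀, hi ▸ hσ₀⟩, hW.merge_left hi, fun s hsi => ?_⟩
  rcases hs s with ⟨h1, -⟩ | ⟨h1, h2⟩
  · exact (hJ s hsi).merge_left h1
  · exact (h₂ s).merge_right (by simpa [h1] using h₁ s) h2

/-- A letter label: no copy `![]`, or one copy `![β]` of a point of the letter's clique.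
[cite: LaurentTortoraDeFalco2006, Def. 12] -/
def LetterLabel (b : Bool) (P : Point) : Prop := P = bang0 ∨ ∃ β ∈ bitClique b, P = bang1 β

/-- A derivation of `c N` has `c` in its context. [cite: GaboardiMarionRonchidellarocca2008, Table 2] -/
theorem app1_present : {d : ℕ} → {Γ : Ctx} → {M : Term} → {σ : SoftTy} → (D : Deriv d Γ M σ) → {c : ℕ} → {N : Term} →
    M = .app (.var c) N → ∃ τ, Γ c = some τ
  | _, _, _, _, .ax _, _, _, hM => by cases hM
  | _, _, _, _, .weak j A h hj hΓ', c, N, hM => by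
      obtain ⟨τ, hτ⟩ := app1_present h hM
      have hcj : c ≠ j := fun e => by rw [e, hj] at hτ; cases hτ
      exact ⟨τ, by rw [hΓ', Function.update_of_ne hcj, hτ]⟩
  | _, _, _, _, .lam _, _, _, hM => by cases hM
  | _, _, _, _, .app (Γ := Γ) hs h₁ _, c, N, hM => by
      cases hM
      obtain ⟨τ, hτ⟩ := var_present h₁ rfl rfl
      rcases hs c with ⟨h1, -⟩ | ⟨h1, -⟩
      · exact ⟨τ, h1 ▸ hτ⟩
      · rw [h1] at hτ; cases hτ
  | _, _, _, _, .mpx (Γ := Γ) (σ := τ₀) S j h hS hj hΓ' hM', c, N, hM => by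
      rw [hM] at hM'
      obtain ⟨F', N', e, hF, -⟩ := rename_eq_app hM'.symm
      obtain ⟨c', rfl, hc'⟩ := rename_eq_var hF
      obtain ⟨τ, hτ⟩ := app1_present h e
      have hjS : j ∉ S := fun hj' => by simpa [hj] using hS j hj'
      have hcj : c' ≠ j := fun e => by rw [e, hj] at hτ; cases hτ
      by_cases hcS : c' ∈ S
      · have : c = j := by rw [← hc']; simp [mpxRen, hcS]
        exact ⟨τ₀.bang, by rw [hΓ', this]; simp [Ctx.mpx, hjS]⟩
      · have : c = c' := by rw [← hc']; simp [mpxRen, hcS]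
        exact ⟨τ, by rw [hΓ', this]; simp [Ctx.mpx, hcS, hcj, hτ]⟩
  | _, _, _, _, .sp h _, _, _, hM => by
      obtain ⟨τ, hτ⟩ := app1_present h hM
      exact ⟨τ.bang, by subst_vars; simp [Ctx.bang, hτ]⟩
  | _, _, _, _, .allI (Γ := Γ) h hΔ, _, _, hM => by
      obtain ⟨τ, hτ⟩ := app1_present h hM
      rw [hΔ] at hτ
      simp only [Ctx.shift, Option.map_eq_some_iff] at hτ
      obtain ⟨τ', hτ', -⟩ := hτ
      exact ⟨τ', hτ'⟩
  | _, _, _, _, .allE _ h, _, _, hM => app1_present h hM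
  | _, _, _, _, .sum _ _, _, _, hM => by cases hM

/-- **Runs of an applied letter `c b̲`.** For `c` of kernel `B₁ ⊸ A₁` (`B₁` BoolLike) every run with result `p` takes
at most one copy `Pb` of a point of the letter and has slot `c` wrapped around `![Pb‾ ⅋ p]`, junk elsewhere.
[cite: LaurentTortoraDeFalco2006, Def. 12] -/
theorem app1_runs : {d : ℕ} → {Γ : Ctx} → {M : Term} → {σ : SoftTy} → (D : Deriv d Γ M σ) → {c k : ℕ} →
    {B₁ A₁ : LinTy} → {b : Bool} → M = .app (.var c) (encBit b) → σ.bangs = 0 →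
    Γ c = some ⟨k, .limp 0 B₁ A₁⟩ → BoolLike B₁ →
      ∀ {ρ : Val} {p : Point}, (ρ, p) ∈ D.interp → ∃ Pb, LetterLabel b Pb ∧ VarSpec Γ c ρ (Pb.dual.par p)
  | _, _, _, _, .ax _, _, _, _, _, _, hM, _, _, _, _, _, _ => by cases hM
  | _, _, _, _, .weak j A h hj hΓ', c, k, B₁, A₁, b, hM, hσ, hΓ, hB, ρ, p, hr => by
      obtain ⟨τ, hτ⟩ := app1_present h hM
      have hcj : c ≠ j := fun e => by rw [e, hj] at hτ; cases hτ
      rw [hΓ', Function.update_of_ne hcj] at hΓ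
      obtain ⟨ρ', p', hm, he⟩ := hr
      obtain ⟨Pb, hPb, hV⟩ := app1_runs h hM hσ hΓ hB hm
      simp only [Prod.mk.injEq] at he
      obtain ⟨rfl, rfl⟩ := he
      subst hΓ'
      exact ⟨Pb, hPb, hV.weak hj A⟩
  | _, _, _, _, .lam _, _, _, _, _, _, hM, _, _, _, _, _, _ => by cases hM
  | _, _, _, _, .app (Γ := Γ) (Γ₁ := Γ₁) (Γ₂ := Γ₂) (k := k') (B := B') (A := A') hs h₁ h₂, c, k, B₁, A₁, b, hM, _,
      hΓ, hB, ρ, p, hr => by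
      cases hM
      -- `c` sits on the function side, with its kernel
      obtain ⟨τ, hτ⟩ := var_present h₁ rfl rfl
      have hΓ₁c : Γ₁ c = some ⟨k, .limp 0 B₁ A₁⟩ := by
        rcases hs c with ⟨h1, -⟩ | ⟨h1, -⟩
        · rw [h1, hΓ]
        · rw [h1] at hτ; cases hτ
      -- the literal arrow type of `c` IS its kernel: one linear copy of a BoolLike letter type
      obtain ⟨j, hj⟩ := var_ty h₁ rfl rfl hΓ₁c rfl
      rcases j with _ | j
      · change LinTy.limp k' B' A' = LinTy.limp 0 (B₁.rename (· + 0)) (A₁.rename (· + 0)) at hj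
        simp only [LinTy.limp.injEq] at hj
        obtain ⟨rfl, rfl, rfl⟩ := hj
        obtain ⟨ρ₁, ρ₂, V, p', hm₁, hm₂, he⟩ := hr
        simp only [Prod.mk.injEq] at he
        obtain ⟨rfl, rfl⟩ := he
        have hV₁ := var_runs h₁ rfl rfl hm₁
        have hsome₁ : ∀ s, (ρ₁ s).isSome = (Γ₁ s).isSome := h₁.isSome_of_mem_interp hm₁
        have hB' : BoolLike (B₁.rename (· + 0)) := hB.rename _
        rcases hm₂ with ⟨ρ₂', β, hβ, he₂⟩ | he₂
        · simp only [Prod.mk.injEq] at he₂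
          obtain ⟨rfl, rfl⟩ := he₂
          obtain ⟨hβm, hJ₂⟩ := bool_runs h₂ rfl rfl hB' hβ
          exact ⟨bang1 β, Or.inr ⟨β, hβm, rfl⟩, hV₁.merge hs hsome₁ hJ₂⟩
        · simp only [Prod.mk.injEq] at he₂
          obtain ⟨rfl, rfl⟩ := he₂
          exact ⟨bang0, Or.inl rfl, hV₁.merge hs hsome₁ (SlotIn.discard Γ₂)⟩
      · change LinTy.limp k' B' A' = LinTy.all _ at hj
        cases hj
  | _, _, _, _, .mpx (Γ := Γ) (σ := τ₀) S j h hS hj hΓ' hM', c, k, B₁, A₁, b, hM, hσ, hΓ, hB, ρ, p, hr => by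
      rw [hM] at hM'
      obtain ⟨F', N', e, hF, hN⟩ := rename_eq_app hM'.symm
      obtain ⟨c', rfl, hc'⟩ := rename_eq_var hF
      have hN' := rename_eq_encBit hN
      rw [hN'] at e
      obtain ⟨τ, hτ⟩ := app1_present h e
      have hjS : j ∉ S := fun hj' => by simpa [hj] using hS j hj'
      have hcj : c' ≠ j := fun e => by rw [e, hj] at hτ; cases hτ
      obtain ⟨ρ', p', hm, he'⟩ := hr
      have hΓc' : ∃ k₀, Γ c' = some ⟨k₀, .limp 0 B₁ A₁⟩ := by
        by_cases hcS : c' ∈ S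
        · have hc : c = j := by rw [← hc']; simp [mpxRen, hcS]
          rw [hΓ', hc] at hΓ
          simp only [Ctx.mpx, hjS, if_false, if_true, Option.some.injEq] at hΓ
          refine ⟨τ₀.bangs, ?_⟩
          rw [hS c' hcS, ← show τ₀.lin = LinTy.limp 0 B₁ A₁ from congrArg SoftTy.lin hΓ]
        · have hc : c = c' := by rw [← hc']; simp [mpxRen, hcS]
          rw [hΓ', hc] at hΓ
          simp only [Ctx.mpx, hcS, if_false, hcj] at hΓ
          exact ⟨k, hΓ⟩
      obtain ⟨k₀, hk₀⟩ := hΓc'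
      obtain ⟨Pb, hPb, hV⟩ := app1_runs h e hσ hk₀ hB hm
      simp only [Prod.mk.injEq] at he'
      obtain ⟨rfl, rfl⟩ := he'
      subst hΓ'
      rw [← hc']
      exact ⟨Pb, hPb, hV.mpx hS hj⟩
  | _, _, _, _, .sp _ _, _, _, _, _, _, _, hσ, _, _, _, _, _ => by simp at hσ
  | _, _, _, _, .allI (Γ := Γ) h hΔ, c, k, B₁, A₁, b, hM, _, hΓ, hB, ρ, p, hr => by
      have hΔc : Γ.shift c = some ⟨k, (LinTy.limp 0 B₁ A₁).rename Nat.succ⟩ := by simp [Ctx.shift, hΓ]; rfl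
      rw [← hΔ] at hΔc
      obtain ⟨Pb, hPb, hV⟩ := app1_runs h hM rfl hΔc (hB.rename _) hr
      rw [hΔ] at hV
      exact ⟨Pb, hPb, hV.of_shift⟩
  | _, _, _, _, .allE _ h, _, _, _, _, _, hM, _, hΓ, hB, _, _, hr => app1_runs h hM rfl hΓ hB hr
  | _, _, _, _, .sum _ _, _, _, _, _, _, hM, _, _, _, _, _, _ => by cases hM

/-- **Existence of runs of an applied letter** with one copy of the letter point of axiom label `a`: slot `c` wrapped
around `![![bitPtAt b a]‾ ⅋ p]`. [cite: LaurentTortoraDeFalco2006, Def. 12] -/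
theorem app1_exists : {d : ℕ} → {Γ : Ctx} → {M : Term} → {σ : SoftTy} → (D : Deriv d Γ M σ) → {c k : ℕ} →
    {B₁ A₁ : LinTy} → {b : Bool} → M = .app (.var c) (encBit b) → σ.bangs = 0 →
    Γ c = some ⟨k, .limp 0 B₁ A₁⟩ → BoolLike B₁ →
      ∀ a p : Point, ∃ ρ : Val, (ρ, p) ∈ D.interp ∧ VarSpec Γ c ρ ((bang1 (bitPtAt b a)).dual.par p)
  | _, _, _, _, .ax _, _, _, _, _, _, hM, _, _, _, _, _ => by cases hM
  | _, _, _, _, .weak j A h hj hΓ', c, k, B₁, A₁, b, hM, hσ, hΓ, hB, a, p => by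
      obtain ⟨τ, hτ⟩ := app1_present h hM
      have hcj : c ≠ j := fun e => by rw [e, hj] at hτ; cases hτ
      rw [hΓ', Function.update_of_ne hcj] at hΓ
      obtain ⟨ρ, hm, hV⟩ := app1_exists h hM hσ hΓ hB a p
      subst hΓ'
      exact ⟨_, ⟨ρ, p, hm, rfl⟩, hV.weak hj A⟩
  | _, _, _, _, .lam _, _, _, _, _, _, hM, _, _, _, _, _ => by cases hM
  | _, _, _, _, .app (Γ := Γ) (Γ₁ := Γ₁) (Γ₂ := Γ₂) (k := k') (B := B') (A := A') hs h₁ h₂, c, k, B₁, A₁, b, hM, _,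
      hΓ, hB, a, p => by
      cases hM
      obtain ⟨τ, hτ⟩ := var_present h₁ rfl rfl
      have hΓ₁c : Γ₁ c = some ⟨k, .limp 0 B₁ A₁⟩ := by
        rcases hs c with ⟨h1, -⟩ | ⟨h1, -⟩
        · rw [h1, hΓ]
        · rw [h1] at hτ; cases hτ
      obtain ⟨j, hj⟩ := var_ty h₁ rfl rfl hΓ₁c rfl
      rcases j with _ | j
      · change LinTy.limp k' B' A' = LinTy.limp 0 (B₁.rename (· + 0)) (A₁.rename (· + 0)) at hj
        simp only [LinTy.limp.injEq] at hj
        obtain ⟨rfl, rfl, rfl⟩ := hj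
        have hB' : BoolLike (B₁.rename (· + 0)) := hB.rename _
        obtain ⟨ρ₂, hβ⟩ := bool_exists h₂ rfl rfl hB' a
        obtain ⟨ρ₁, hm₁⟩ := var_exists h₁ rfl rfl ((bang1 (bitPtAt b a)).dual.par p)
        have hsome₁ : ∀ s, (ρ₁ s).isSome = (Γ₁ s).isSome := h₁.isSome_of_mem_interp hm₁
        refine ⟨Val.merge ρ₁ ρ₂, ⟨ρ₁, ρ₂, bang1 (bitPtAt b a), p, hm₁, Or.inl ⟨ρ₂, _, hβ, rfl⟩, rfl⟩, ?_⟩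
        exact (var_runs h₁ rfl rfl hm₁).merge hs hsome₁ (bool_runs h₂ rfl rfl hB' hβ).2
      · change LinTy.limp k' B' A' = LinTy.all _ at hj
        cases hj
  | _, _, _, _, .mpx (Γ := Γ) (σ := τ₀) S j h hS hj hΓ' hM', c, k, B₁, A₁, b, hM, hσ, hΓ, hB, a, p => by
      rw [hM] at hM'
      obtain ⟨F', N', e, hF, hN⟩ := rename_eq_app hM'.symm
      obtain ⟨c', rfl, hc'⟩ := rename_eq_var hF
      have hN' := rename_eq_encBit hN
      rw [hN'] at e
      obtain ⟨τ, hτ⟩ := app1_present h e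
      have hjS : j ∉ S := fun hj' => by simpa [hj] using hS j hj'
      have hcj : c' ≠ j := fun e => by rw [e, hj] at hτ; cases hτ
      have hΓc' : ∃ k₀, Γ c' = some ⟨k₀, .limp 0 B₁ A₁⟩ := by
        by_cases hcS : c' ∈ S
        · have hc : c = j := by rw [← hc']; simp [mpxRen, hcS]
          rw [hΓ', hc] at hΓ
          simp only [Ctx.mpx, hjS, if_false, if_true, Option.some.injEq] at hΓ
          refine ⟨τ₀.bangs, ?_⟩
          rw [hS c' hcS, ← show τ₀.lin = LinTy.limp 0 B₁ A₁ from congrArg SoftTy.lin hΓ]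
        · have hc : c = c' := by rw [← hc']; simp [mpxRen, hcS]
          rw [hΓ', hc] at hΓ
          simp only [Ctx.mpx, hcS, if_false, hcj] at hΓ
          exact ⟨k, hΓ⟩
      obtain ⟨k₀, hk₀⟩ := hΓc'
      obtain ⟨ρ, hm, hV⟩ := app1_exists h e hσ hk₀ hB a p
      subst hΓ'
      rw [← hc']
      exact ⟨_, ⟨ρ, p, hm, rfl⟩, hV.mpx hS hj⟩
  | _, _, _, _, .sp _ _, _, _, _, _, _, _, hσ, _, _, _, _ => by simp at hσ
  | _, _, _, _, .allI (Γ := Γ) h hΔ, c, k, B₁, A₁, b, hM, _, hΓ, hB, a, p => by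
      have hΔc : Γ.shift c = some ⟨k, (LinTy.limp 0 B₁ A₁).rename Nat.succ⟩ := by simp [Ctx.shift, hΓ]; rfl
      rw [← hΔ] at hΔc
      obtain ⟨ρ, hm, hV⟩ := app1_exists h hM rfl hΔc (hB.rename _) a p
      rw [hΔ] at hV
      exact ⟨ρ, hm, hV.of_shift⟩
  | _, _, _, _, .allE _ h, _, _, _, _, _, hM, _, hΓ, hB, a, p => app1_exists h hM rfl hΓ hB a p
  | _, _, _, _, .sum _ _, _, _, _, _, _, hM, _, _, _, _, _ => by cases hM

/-- **The quantifier tower of an applied variable.** For `c` of non-quantified kernel `K`: `K` is an arrow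
`B₁ ⊸ᵏ¹ A₁`, and if `A₁` is non-quantified the type of any derivation of `Γ ⊢ c N : T` is `∀ʲ A₁⁺ʲ`.
[cite: GaboardiMarionRonchidellarocca2008, Table 2] -/
theorem app1_ty : {d : ℕ} → {Γ : Ctx} → {M : Term} → {σ : SoftTy} → (D : Deriv d Γ M σ) → {c k : ℕ} → {K : LinTy} →
    {N : Term} → M = .app (.var c) N → σ.bangs = 0 → Γ c = some ⟨k, K⟩ → peel K = K →
      ∃ k₁ B₁ A₁, K = .limp k₁ B₁ A₁ ∧ (peel A₁ = A₁ → ∃ j, σ.lin = allN j (A₁.rename (· + j)))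
  | _, _, _, _, .ax _, _, _, _, _, hM, _, _, _ => by cases hM
  | _, _, _, _, .weak j A h hj hΓ', c, k, K, N, hM, hσ, hΓ, hK => by
      obtain ⟨τ, hτ⟩ := app1_present h hM
      have hcj : c ≠ j := fun e => by rw [e, hj] at hτ; cases hτ
      rw [hΓ', Function.update_of_ne hcj] at hΓ
      exact app1_ty h hM hσ hΓ hK
  | _, _, _, _, .lam _, _, _, _, _, hM, _, _, _ => by cases hM
  | _, _, _, _, .app (Γ := Γ) (Γ₁ := Γ₁) (k := k') (B := B') (A := A') hs h₁ h₂, c, k, K, N, hM, _, hΓ, hK => by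
      cases hM
      obtain ⟨τ, hτ⟩ := var_present h₁ rfl rfl
      have hΓ₁c : Γ₁ c = some ⟨k, K⟩ := by
        rcases hs c with ⟨h1, -⟩ | ⟨h1, -⟩
        · rw [h1, hΓ]
        · rw [h1] at hτ; cases hτ
      obtain ⟨j, hj⟩ := var_ty h₁ rfl rfl hΓ₁c hK
      rcases j with _ | j
      · change LinTy.limp k' B' A' = K.rename (· + 0) at hj
        cases K with
        | tvar _ => cases hj
        | all _ => exact absurd hK (peel_ne_all _ _)
        | limp k₁ B₁ A₁ =>
          refine ⟨k₁, B₁, A₁, rfl, fun _ => ⟨0, ?_⟩⟩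
          simp only [STA.LinTy.rename, LinTy.limp.injEq] at hj
          exact hj.2.2
      · change LinTy.limp k' B' A' = LinTy.all _ at hj
        cases hj
  | _, _, _, _, .mpx (Γ := Γ) (σ := τ₀) S j h hS hj hΓ' hM', c, k, K, N, hM, hσ, hΓ, hK => by
      rw [hM] at hM'
      obtain ⟨F', N', e, hF, -⟩ := rename_eq_app hM'.symm
      obtain ⟨c', rfl, hc'⟩ := rename_eq_var hF
      obtain ⟨τ, hτ⟩ := app1_present h e
      have hjS : j ∉ S := fun hj' => by simpa [hj] using hS j hj'
      have hcj : c' ≠ j := fun e => by rw [e, hj] at hτ; cases hτ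
      by_cases hcS : c' ∈ S
      · have hc : c = j := by rw [← hc']; simp [mpxRen, hcS]
        rw [hΓ', hc] at hΓ
        simp only [Ctx.mpx, hjS, if_false, if_true, Option.some.injEq] at hΓ
        have hτK : τ₀.lin = K := congrArg SoftTy.lin hΓ
        exact app1_ty h e hσ (k := τ₀.bangs) (by rw [hS c' hcS, ← hτK]) hK
      · have hc : c = c' := by rw [← hc']; simp [mpxRen, hcS]
        rw [hΓ', hc] at hΓ
        simp only [Ctx.mpx, hcS, if_false, hcj] at hΓ
        exact app1_ty h e hσ hΓ hK
  | _, _, _, _, .sp _ _, _, _, _, _, _, hσ, _, _ => by simp at hσ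
  | _, _, _, _, .allI (Γ := Γ) (A := A) h hΔ, c, k, K, N, hM, _, hΓ, hK => by
      have hΔc : Γ.shift c = some ⟨k, K.rename Nat.succ⟩ := by simp [Ctx.shift, hΓ]; rfl
      rw [← hΔ] at hΔc
      obtain ⟨k₁, B₁, A₁, hK₁, hj⟩ := app1_ty h hM rfl hΔc (peel_rename_of_peel_eq hK _)
      cases K with
      | tvar _ => cases hK₁
      | all _ => exact absurd hK (peel_ne_all _ _)
      | limp k₀ B₀ A₀ =>
        simp only [STA.LinTy.rename, LinTy.limp.injEq] at hK₁
        obtain ⟨rfl, rfl, rfl⟩ := hK₁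
        refine ⟨k₀, B₀, A₀, rfl, fun hA₀ => ?_⟩
        obtain ⟨j, hj⟩ := hj (peel_rename_of_peel_eq hA₀ _)
        refine ⟨j + 1, ?_⟩
        change A = _ at hj
        change LinTy.all A = LinTy.all _
        have hf : ((fun x => x + j) ∘ Nat.succ) = (fun x => x + (j + 1)) := by
          funext x; show x.succ + j = x + (j + 1); omega
        rw [hj, STA.LinTy.rename_rename, hf]
  | _, _, _, _, .allE A' h, c, k, K, N, hM, _, hΓ, hK => by
      obtain ⟨k₁, B₁, A₁, hK₁, hj⟩ := app1_ty h hM rfl hΓ hK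
      refine ⟨k₁, B₁, A₁, hK₁, fun hA₁ => ?_⟩
      obtain ⟨j, hj⟩ := hj hA₁
      obtain ⟨j', rfl, hB⟩ := allN_eq_all hA₁ hj
      refine ⟨j', ?_⟩
      show LinTy.inst _ A' = _
      rw [hB, inst_allN_rename]
  | _, _, _, _, .sum _ _, _, _, _, _, hM, _, _, _ => by cases hM

end Summit.PneNP.PneNP.Theorems.OracleRefusal.Negative
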